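import Summits.BirchSwinnertonDyer.Rank1Residual.Additive.DisegniLineGrossZagier
import HarnessLib

/-!
# STEP C⁻(2), algebraic bookkeeping (odd branch): the two field identities behind the minus-branch
# `p`-adic Gross–Zagier identity (cell `bsd-addord`, seat `bsd-addord-gz` gen 4)

HONEST FRAMING (cell `bsd-addord`; PARTITION (D-0054): EXCLUDED-DOMAIN additive rows §E, B6 = O7-ord r1 ×
every consumer of hFact, rows `p ≡ 3 (mod 4)` — types-the-object-of; booked 0). THEOREMS ONLY, pure algebra
(no number theory): `arch_algebra_odd` (in `ℂ`, with `i² = −1`) and `padic_algebra_odd` (in `ℚ_p`, with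
`p* = −p`), the odd twins of `arch_algebra` / `padic_algebra` of `DisegniLineGrossZagier`; split off from
`DisegniLineGrossZagierOdd` for the 400-line rule.

References: [Disegni2017] Thm. B, (1.1.3).
-/

set_option autoImplicit false

noncomputable section

open scoped Classical

namespace Summit.BirchSwinnertonDyer.Rank1Residual.Additive

section AlgebraOdd

variable {p : ℕ} [hp : Fact p.Prime]

/-- **The archimedean bookkeeping, odd branch** (pure field algebra in `ℂ`): from (1.1.3) in the form
`ρ·R = (q/2)·Car·(c·Ω·R·L)`, odd Birch `S·Ω⁻_{f′}·i = τ·L`, `i·τ·√p = ε·p`, `Ω⁻_f = ϖ·Ω⁻_V`,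
`Ω⁻_V = Ω·√p/m₀`: `ρ ≠ 0` and `−u·Car·Ω⁻_f·Ω⁻_{f′} = ε·2uϖρp/(q c m₀ S)`.
[cite: Disegni2017, (1.1.3) (arXiv v3 PDF pp. 4–5)] -/
theorem arch_algebra_odd {ρ q c S u ϖ ε m₀ : ℚ} {p' : ℕ} {Car Ω R Ωf Ωf' ΩV sq : ℝ} {τ L : ℂ}
    (hA : (ρ : ℂ) * R = (q : ℂ) / 2 * Car * ((c : ℂ) * Ω * R * L))
    (hB : ((S : ℚ) : ℂ) * Ωf' * Complex.I = τ * L)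
    (hτ : Complex.I * τ * (sq : ℂ) = (ε : ℂ) * (p' : ℂ))
    (hΩf : (Ωf : ℂ) = (ϖ : ℂ) * ΩV) (hΩV : (ΩV : ℂ) = (Ω : ℂ) * sq / (m₀ : ℂ))
    (hR : (R : ℂ) ≠ 0) (hΩ : (Ω : ℂ) ≠ 0) (hq : (q : ℂ) ≠ 0) (hc : (c : ℂ) ≠ 0) (hS : (S : ℂ) ≠ 0)
    (hCar : (Car : ℂ) ≠ 0) (hΩf' : (Ωf' : ℂ) ≠ 0) (hm₀ : (m₀ : ℂ) ≠ 0) :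
    ρ ≠ 0 ∧ -(u : ℂ) * Car * Ωf * Ωf' = ((ε * (2 * u * ϖ * ρ * p' / (q * c * m₀ * S)) : ℚ) : ℂ) := by
  have h1 : (ρ : ℂ) = (q : ℂ) / 2 * Car * c * Ω * L := by
    apply mul_right_cancel₀ hR
    linear_combination hA
  have hB' : ((S : ℚ) : ℂ) * Ωf' = -(Complex.I * τ * L) := by
    linear_combination (-Complex.I) * hB + (((S : ℚ) : ℂ) * (Ωf' : ℂ)) * Complex.I_mul_I
  have hρ : ρ ≠ 0 := by
    intro hρ0
    rw [hρ0, Rat.cast_zero] at h1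
    have hL : L = 0 := by
      have h0 : (q : ℂ) / 2 * Car * c * Ω * L = 0 := h1.symm
      have hA0 : (q : ℂ) / 2 * Car * c * Ω ≠ 0 :=
        mul_ne_zero (mul_ne_zero (mul_ne_zero (div_ne_zero hq two_ne_zero) hCar) hc) hΩ
      exact (mul_eq_zero.mp h0).resolve_left hA0
    rw [hL, mul_zero, neg_zero] at hB'
    exact mul_ne_zero hS hΩf' hB'
  refine ⟨hρ, ?_⟩
  have hΩf'eq : (Ωf' : ℂ) = -(Complex.I * τ * L) / (S : ℂ) := by
    field_simp
    linear_combination hB'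
  calc -(u : ℂ) * Car * Ωf * Ωf'
      = (u : ℂ) * Car * ϖ * Ω * L / ((m₀ : ℂ) * (S : ℂ)) * (Complex.I * τ * (sq : ℂ)) := by
        rw [hΩf, hΩV, hΩf'eq]; field_simp
    _ = (u : ℂ) * Car * ϖ * Ω * L / ((m₀ : ℂ) * (S : ℂ)) * ((ε : ℂ) * (p' : ℂ)) := by rw [hτ]
    _ = ((ε * (2 * u * ϖ * ρ * p' / (q * c * m₀ * S)) : ℚ) : ℂ) := by
        push_cast
        rw [h1]
        field_simp

/-- **The `p`-adic bookkeeping, odd branch** (pure field algebra in `ℚ_p`): Theorem B in the form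
`ρ·Reg = σ q (u·(−p)·α⁻²)⁻¹ ½ ℓ · (ε·2uϖρp/(q c m₀ S)) · B · α⁻¹S` gives `ϖ·B·ℓ = (−σεα⁻¹m₀)·c·Reg`.
[cite: Disegni2017, Theorem B (arXiv v3 PDF p. 9)] -/
theorem padic_algebra_odd {ρ q c S u ϖ ε m₀ : ℚ} {σ : ℤ} {pp α ℓ B Reg : ℚ_[p]}
    (hPad : (ρ : ℚ_[p]) * Reg = (σ : ℚ_[p]) * (q : ℚ_[p]) *
        (((u : ℚ_[p]) * pp * (α ^ 2)⁻¹)⁻¹ * 2⁻¹ * ℓ) *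
        (((ε * (2 * u * ϖ * ρ * p / (q * c * m₀ * S)) : ℚ) : ℚ_[p]) * B * (α⁻¹ * (S : ℚ_[p]))))
    (hpp : pp = -(p : ℚ_[p])) (hs2 : ((σ : ℚ_[p]) * (ε : ℚ_[p])) ^ 2 = 1)
    (hρ : (ρ : ℚ_[p]) ≠ 0) (hq : (q : ℚ_[p]) ≠ 0) (hc : (c : ℚ_[p]) ≠ 0) (hS : (S : ℚ_[p]) ≠ 0)
    (hu : (u : ℚ_[p]) ≠ 0) (hα : α ≠ 0) (hp0 : (p : ℚ_[p]) ≠ 0) (hm₀ : (m₀ : ℚ_[p]) ≠ 0) :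
    (ϖ : ℚ_[p]) * B * ℓ = (-((σ : ℚ_[p]) * (ε : ℚ_[p])) * α⁻¹ * (m₀ : ℚ_[p])) * (c : ℚ_[p]) * Reg := by
  subst hpp
  have h3 : (ρ : ℚ_[p]) * Reg =
      -((σ : ℚ_[p]) * (ε : ℚ_[p]) * α * (ϖ : ℚ_[p]) * (ρ : ℚ_[p]) * ℓ * B) / ((c : ℚ_[p]) * m₀) := by
    rw [hPad]
    push_cast
    field_simp
  have h4 : (c : ℚ_[p]) * m₀ * Reg = -((σ : ℚ_[p]) * (ε : ℚ_[p]) * α * (ϖ : ℚ_[p]) * ℓ * B) := by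
    have h5 : (c : ℚ_[p]) * m₀ * ((ρ : ℚ_[p]) * Reg) =
        (ρ : ℚ_[p]) * -((σ : ℚ_[p]) * (ε : ℚ_[p]) * α * (ϖ : ℚ_[p]) * ℓ * B) := by
      rw [h3]; field_simp
    apply mul_left_cancel₀ hρ
    linear_combination h5
  calc (ϖ : ℚ_[p]) * B * ℓ
      = ((σ : ℚ_[p]) * (ε : ℚ_[p])) ^ 2 * ((ϖ : ℚ_[p]) * B * ℓ) := by rw [hs2, one_mul]
    _ = (-((σ : ℚ_[p]) * (ε : ℚ_[p])) * α⁻¹ * (m₀ : ℚ_[p])) *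
          (-((σ : ℚ_[p]) * (ε : ℚ_[p]) * α * (ϖ : ℚ_[p]) * ℓ * B)) / (m₀ : ℚ_[p]) := by
        field_simp
    _ = (-((σ : ℚ_[p]) * (ε : ℚ_[p])) * α⁻¹ * (m₀ : ℚ_[p])) * ((c : ℚ_[p]) * m₀ * Reg) / (m₀ : ℚ_[p]) := by
        rw [h4]
    _ = (-((σ : ℚ_[p]) * (ε : ℚ_[p])) * α⁻¹ * (m₀ : ℚ_[p])) * (c : ℚ_[p]) * Reg := by
        field_simp

end AlgebraOdd

end Summit.BirchSwinnertonDyer.Rank1Residual.Additive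

end
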